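import Literature.Analysis.FluidPDE.EnvelopeEnergyInequality
import Mathlib.MeasureTheory.Integral.IntervalIntegral.FundThmCalculus
import Mathlib.MeasureTheory.Integral.DominatedConvergence
import Mathlib.Topology.Order.Monotone
import HarnessLib

/-!
# The generalized energy inequality from an a.e.-restarted energy inequality

Analysis/FluidPDE support file (folklore real analysis; serves the discharge of
`Literature.Analysis.FluidPDE.timeAverage_isStationary`, Foias–Manley–Rosa–Temam 2001, Ch. IV
Thm. 3.1, property (1.31)). Continuation of `EnvelopeEnergyInequality` (the envelope `m`,
uniform partitions and step functions are there); this file proves the main statement: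

* `intervalIntegral_le_integral_mul_of_restart` — let `h ∈ L¹(0, T)`, let `G ∋ 0` be a set of
  full measure in `[0, T]`, and let `E : ℝ → ℝ` satisfy the **restarted energy inequality**
  `E(t) - E(s) ≤ ∫ₛᵗ h` for every `s ∈ G` and `t ∈ [s, T]`. Then for every continuous
  `0 ≤ ψ ≤ M`,
  `∫_{E(0)}^{E(T)} ψ ≤ ∫₀ᵀ ψ(E(t)) h(t) dt`
  — the inequality `ρ(|u(T)|²) - ρ(|u₀|²) ≤ ∫₀ᵀ ρ'(|u|²) 2[(f,u) - ν‖u‖²]` of FMRT 2001, App. B.2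
  (display after (B.35), PDF p. 261, with `ρ' = ψ`), obtained there under additional one-sided
  continuity properties of `|u(t)|` and here from the restarted inequality alone.

Proof: with `A = ∫₀h`, `z = E - A` and its nonincreasing envelope `m` through `G`
(`restartEnvelope`), put `Ẽ = m + A` (`E ≤ Ẽ` on `[0,T]`, `E = Ẽ` a.e., `Ẽ(0) = E(0)`) and
`ρ = ∫₀ψ` (nondecreasing). On the uniform partition `tᵢ = iT/n`,
`ρ(Ẽ(tᵢ₊₁)) - ρ(Ẽ(tᵢ)) ≤ ρ(m(tᵢ) + A(tᵢ₊₁)) - ρ(m(tᵢ) + A(tᵢ)) = ψ(ξᵢ) ∫_{tᵢ}^{tᵢ₊₁} h` (mean value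
theorem), so `ρ(Ẽ T) - ρ(Ẽ 0) ≤ ∫₀ᵀ stepₙ h` with `stepₙ(t) = ψ(ξ_{i(t)}) → ψ(Ẽ(t))` at every
continuity point of `m` (all but countably many), and dominated convergence (`|stepₙ h| ≤ M|h|`)
gives `ρ(E T) - ρ(E 0) ≤ ρ(Ẽ T) - ρ(Ẽ 0) ≤ ∫₀ᵀ ψ(Ẽ) h = ∫₀ᵀ ψ(E) h`.

## Mathlib search

Used: `Continuous.integral_hasStrictDerivAt` (FTC-1), `monotone_of_deriv_nonneg`,
`intervalIntegral.continuous_primitive`, `intervalIntegral.integral_interval_sub_left`,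
`Antitone.countable_not_continuousAt`, `Set.Countable.measure_zero`,
`MeasureTheory.tendsto_integral_of_dominated_convergence`, `Finset.sum_range_sub`, and the
envelope/partition infrastructure of `EnvelopeEnergyInequality`. Nothing on energy inequalities
for functions known only through a.e.-restarted integral inequalities exists in Mathlib or the
tree (`RestartedEnergyBound` gives only boundedness).

## References

* C. Foias, O. Manley, R. Rosa, R. Temam, *Navier–Stokes Equations and Turbulence*, Cambridge
  Univ. Press (2001), App. IV.B.2, (B.29)–(B.36) (PDF pp. 259–261). [FMRT2001]
-/

noncomputable section

open MeasureTheory Set Filter Topology intervalIntegral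

namespace Literature.Analysis.FluidPDE

/-- **The generalized energy inequality from the restarted energy inequality.** Let `T > 0`,
`h` integrable on `(0, T]`, `G ⊆ [0, T]` a set containing `0` and almost every point of `(0, T)`,
and `E : ℝ → ℝ` with `E(t) - E(s) ≤ ∫ₛᵗ h` for all `s ∈ G`, `t ∈ [s, T]`. Then for every
continuous `ψ` with `0 ≤ ψ ≤ M`: `∫_{E(0)}^{E(T)} ψ ≤ ∫₀ᵀ ψ(E(t)) h(t) dt` (FMRT 2001, App. B.2,
display after (B.35), p. 261: `ρ(|u(T)|²) - ρ(|u₀|²) ≤ 2∫₀ᵀ [(f,u) - ν‖u‖²] ρ'(|u|²) dt`,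
`ρ' = ψ`). [cite: FMRT2001, App. B.2 (B.33)–(B.36)] -/
theorem intervalIntegral_le_integral_mul_of_restart {E h : ℝ → ℝ} {T : ℝ} (hT : 0 < T)
    {G : Set ℝ} (hG0 : (0 : ℝ) ∈ G) (hGT : G ⊆ Icc 0 T) (hGae : ∀ᵐ s ∂volume, s ∈ Ioo 0 T → s ∈ G)
    (hh : IntegrableOn h (Ioc 0 T)) (hE : ∀ s ∈ G, ∀ t ∈ Icc s T, E t - E s ≤ ∫ τ in s..t, h τ)
    {ψ : ℝ → ℝ} (hψc : Continuous ψ) (hψ0 : ∀ x, 0 ≤ ψ x) {M : ℝ} (hψM : ∀ x, ψ x ≤ M) :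
    ∫ x in E 0..E T, ψ x ≤ ∫ τ in (0 : ℝ)..T, ψ (E τ) * h τ := by
  have hM0 : 0 ≤ M := (hψ0 0).trans (hψM 0)
  -- the integrable extension of `h` and its primitive `A`
  set h' : ℝ → ℝ := (Ioc 0 T).indicator h with hh'def
  have hh' : Integrable h' volume := hh.integrable_indicator measurableSet_Ioc
  have hh'_eq : ∀ τ ∈ Ioc 0 T, h' τ = h τ := fun τ hτ => indicator_of_mem hτ _
  set A : ℝ → ℝ := fun t => ∫ x in (0 : ℝ)..t, h' x with hA
  have hAc : Continuous A := continuous_primitive (fun _ _ => hh'.intervalIntegrable) 0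
  have hA0 : A 0 = 0 := integral_same
  have hA_sub : ∀ s t, A t - A s = ∫ x in s..t, h' x := fun s t =>
    integral_interval_sub_left hh'.intervalIntegrable hh'.intervalIntegrable
  have hh_int_eq : ∀ s t, 0 ≤ s → s ≤ t → t ≤ T → ∫ x in s..t, h x = ∫ x in s..t, h' x := by
    intro s t hs hst htT
    refine integral_congr_ae (ae_of_all _ fun x hx => ?_)
    rw [uIoc_of_le hst] at hx
    exact (hh'_eq x ⟨hs.trans_lt hx.1, hx.2.trans htT⟩).symm
  -- `z = E - A` and its nonincreasing envelope `m` through the good points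
  set z : ℝ → ℝ := fun t => E t - A t with hz
  have hz_le : ∀ s ∈ G, ∀ t ∈ Icc s T, z t ≤ z s := by
    intro s hs t ht
    have h1 := hE s hs t ht
    rw [hh_int_eq s t (hGT hs).1 ht.1 ht.2, ← hA_sub] at h1
    simp only [hz]
    linarith
  set m : ℝ → ℝ := restartEnvelope z G with hm
  have hm_anti : Antitone m := restartEnvelope_antitone hG0 hGT hz_le
  have hzm : ∀ t ∈ Icc 0 T, z t ≤ m t := fun t ht => le_restartEnvelope hG0 hz_le ht
  have hmz : ∀ t ∈ G, m t = z t := fun t ht => restartEnvelope_eq hG0 hGT hz_le ht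
  -- the modified energy `Ẽ = m + A`
  set Et : ℝ → ℝ := fun t => m t + A t with hEt
  have hEt0 : Et 0 = E 0 := by
    simp only [hEt, hmz 0 hG0, hz, hA0]
    ring
  have hET_le : E T ≤ Et T := by
    have := hzm T ⟨hT.le, le_rfl⟩
    simp only [hEt, hz] at this ⊢
    linarith
  have hEt_ae : ∀ᵐ τ ∂volume, τ ∈ Ioo 0 T → Et τ = E τ := by
    filter_upwards [hGae] with τ hτ hmem
    simp only [hEt, hmz τ (hτ hmem), hz]
    ring
  -- `ρ = ∫₀ ψ`, nondecreasing, with derivative `ψ`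
  set ρ : ℝ → ℝ := fun e => ∫ x in (0 : ℝ)..e, ψ x with hρ
  have hρ' : ∀ e, HasDerivAt ρ (ψ e) e := fun e => (hψc.integral_hasStrictDerivAt 0 e).hasDerivAt
  have hρ_mono : Monotone ρ :=
    monotone_of_deriv_nonneg (fun e => (hρ' e).differentiableAt) fun e => by
      rw [(hρ' e).deriv]; exact hψ0 e
  have hρ_sub : ∀ p q, ρ q - ρ p = ∫ x in p..q, ψ x := fun p q =>
    integral_interval_sub_left (hψc.intervalIntegrable _ _) (hψc.intervalIntegrable _ _)
  -- mean value points
  choose ξf hξf_mem hξf_eq using fun p q => exists_sub_eq_deriv_mul hρ' p q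
  set c : ℕ → ℕ → ℝ := fun n i =>
    ψ (ξf (m (ptn T n i) + A (ptn T n i)) (m (ptn T n i) + A (ptn T n (i + 1)))) with hc
  -- the partition inequality `ρ(Ẽ T) - ρ(Ẽ 0) ≤ ∫ stepₙ h'`
  have hstep_le : ∀ n : ℕ, n ≠ 0 →
      ρ (Et T) - ρ (Et 0) ≤ ∫ τ in Ioc 0 T, stepFun T n (c n) τ * h' τ := by
    intro n hn
    have htel : ρ (Et T) - ρ (Et 0) =
        ∑ i ∈ Finset.range n, (ρ (Et (ptn T n (i + 1))) - ρ (Et (ptn T n i))) := by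
      rw [Finset.sum_range_sub (fun i => ρ (Et (ptn T n i))) n, ptn_self hn, ptn_zero]
    have hterm : ∀ i ∈ Finset.range n, ρ (Et (ptn T n (i + 1))) - ρ (Et (ptn T n i)) ≤
        c n i * ∫ τ in Ioc (ptn T n i) (ptn T n (i + 1)), h' τ := by
      intro i _
      have hab : ptn T n i ≤ ptn T n (i + 1) := ptn_mono hT.le n (Nat.le_succ i)
      have h1 : ρ (Et (ptn T n (i + 1))) ≤ ρ (m (ptn T n i) + A (ptn T n (i + 1))) :=
        hρ_mono (add_le_add (hm_anti hab) le_rfl)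
      have h2 : ρ (m (ptn T n i) + A (ptn T n (i + 1))) - ρ (m (ptn T n i) + A (ptn T n i)) =
          c n i * (A (ptn T n (i + 1)) - A (ptn T n i)) := by
        rw [hξf_eq (m (ptn T n i) + A (ptn T n i)) (m (ptn T n i) + A (ptn T n (i + 1)))]
        simp only [hc]
        ring
      have h3 : A (ptn T n (i + 1)) - A (ptn T n i) = ∫ τ in Ioc (ptn T n i) (ptn T n (i + 1)), h' τ := by
        rw [hA_sub, integral_of_le hab]
      have h4 : ρ (Et (ptn T n i)) = ρ (m (ptn T n i) + A (ptn T n i)) := rfl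
      rw [h4, ← h3, ← h2]
      linarith
    rw [htel, setIntegral_stepFun_mul hT.le hn (c n) hh'.integrableOn]
    exact Finset.sum_le_sum hterm
  -- a.e. convergence of the step functions to `ψ ∘ Ẽ`
  have hTn : Tendsto (fun n : ℕ => T / n) atTop (𝓝 0) := tendsto_const_div_atTop_nhds_zero_nat T
  have hconv : ∀ᵐ τ ∂volume, τ ∈ Ioo 0 T →
      Tendsto (fun n => stepFun T n (c n) τ) atTop (𝓝 (ψ (Et τ))) := by
    have hcount : {x | ¬ContinuousAt m x}.Countable := hm_anti.countable_not_continuousAt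
    have hae : ∀ᵐ τ ∂volume, ContinuousAt m τ := by
      have h0 : volume {x | ¬ContinuousAt m x} = 0 := hcount.measure_zero volume
      exact compl_mem_ae_iff.2 h0 |> fun h => Filter.mem_of_superset h (fun τ hτ => by
        simpa [Set.mem_compl_iff] using hτ)
    filter_upwards [hae] with τ hτc hτmem
    have hτ' : τ ∈ Ioc 0 T := ⟨hτmem.1, hτmem.2.le⟩
    set i : ℕ → ℕ := fun n => ptnIdx T n τ with hi
    -- the endpoints of the interval containing `τ` tend to `τ`
    have hbds : ∀ n : ℕ, n ≠ 0 → τ - T / n ≤ ptn T n (i n) ∧ ptn T n (i n) ≤ τ ∧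
        τ ≤ ptn T n (i n + 1) ∧ ptn T n (i n + 1) ≤ τ + T / n := by
      intro n hn
      obtain ⟨-, hmem⟩ := ptnIdx_spec hT hn hτ'
      have hd := ptn_succ_sub T n (i n)
      exact ⟨by linarith [hmem.2], hmem.1.le, hmem.2, by linarith [hmem.1]⟩
    have hlow : Tendsto (fun n : ℕ => τ - T / n) atTop (𝓝 τ) := by
      simpa using tendsto_const_nhds.sub hTn
    have hup : Tendsto (fun n : ℕ => τ + T / n) atTop (𝓝 τ) := by
      simpa using tendsto_const_nhds.add hTn
    have hti : Tendsto (fun n => ptn T n (i n)) atTop (𝓝 τ) :=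
      tendsto_of_tendsto_of_tendsto_of_le_of_le' hlow tendsto_const_nhds
        ((eventually_ne_atTop 0).mono fun n hn => (hbds n hn).1)
        ((eventually_ne_atTop 0).mono fun n hn => (hbds n hn).2.1)
    have hti1 : Tendsto (fun n => ptn T n (i n + 1)) atTop (𝓝 τ) :=
      tendsto_of_tendsto_of_tendsto_of_le_of_le' tendsto_const_nhds hup
        ((eventually_ne_atTop 0).mono fun n hn => (hbds n hn).2.2.1)
        ((eventually_ne_atTop 0).mono fun n hn => (hbds n hn).2.2.2)
    -- the mean value points tend to `Ẽ τ`
    have hm1 : Tendsto (fun n => m (ptn T n (i n))) atTop (𝓝 (m τ)) := hτc.tendsto.comp hti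
    have hp : Tendsto (fun n => m (ptn T n (i n)) + A (ptn T n (i n))) atTop (𝓝 (Et τ)) :=
      hm1.add ((hAc.tendsto τ).comp hti)
    have hq : Tendsto (fun n => m (ptn T n (i n)) + A (ptn T n (i n + 1))) atTop (𝓝 (Et τ)) :=
      hm1.add ((hAc.tendsto τ).comp hti1)
    have hξ : Tendsto (fun n => ξf (m (ptn T n (i n)) + A (ptn T n (i n)))
        (m (ptn T n (i n)) + A (ptn T n (i n + 1)))) atTop (𝓝 (Et τ)) := by
      refine tendsto_of_tendsto_of_tendsto_of_le_of_le (by simpa using hp.min hq)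
        (by simpa using hp.max hq) (fun n => ?_) (fun n => ?_)
      · exact (hξf_mem _ _).1
      · exact (hξf_mem _ _).2
    have hψξ := (hψc.tendsto _).comp hξ
    refine hψξ.congr' ?_
    filter_upwards [eventually_ne_atTop 0] with n hn
    rw [Function.comp_apply, stepFun_eq hT hn (c n) hτ']
  -- dominated convergence on `(0, T]`
  have hneT : ∀ᵐ τ ∂volume, τ ≠ T := by
    rw [ae_iff]
    simp
  have hlim : Tendsto (fun n => ∫ τ in Ioc 0 T, stepFun T n (c n) τ * h' τ) atTop
      (𝓝 (∫ τ in Ioc 0 T, ψ (Et τ) * h' τ)) := by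
    refine tendsto_integral_of_dominated_convergence (fun τ => M * ‖h' τ‖)
      (fun n => ((measurable_stepFun T n (c n)).aestronglyMeasurable.mul hh'.1).restrict)
      ((hh'.norm.const_mul M).integrableOn) (fun n => ?_) ?_
    · refine (ae_restrict_iff' measurableSet_Ioc).2 (ae_of_all _ fun τ hτ => ?_)
      rw [norm_mul]
      refine mul_le_mul_of_nonneg_right ?_ (norm_nonneg _)
      rcases Nat.eq_zero_or_pos n with hn | hn
      · subst hn
        simp [stepFun, hM0]
      · rw [stepFun_eq hT hn.ne' (c n) hτ, Real.norm_eq_abs, abs_of_nonneg (hψ0 _)]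
        exact hψM _
    · refine (ae_restrict_iff' measurableSet_Ioc).2 ?_
      filter_upwards [hconv, hneT] with τ h1 h2 hτ
      exact (h1 ⟨hτ.1, lt_of_le_of_ne hτ.2 h2⟩).mul_const _
  have hmain : ρ (Et T) - ρ (Et 0) ≤ ∫ τ in Ioc 0 T, ψ (Et τ) * h' τ :=
    ge_of_tendsto hlim ((eventually_ne_atTop 0).mono fun n hn => hstep_le n hn)
  have hrhs : ∫ τ in Ioc 0 T, ψ (Et τ) * h' τ = ∫ τ in (0 : ℝ)..T, ψ (E τ) * h τ := by
    rw [integral_of_le hT.le]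
    refine setIntegral_congr_ae measurableSet_Ioc ?_
    filter_upwards [hEt_ae, hneT] with τ h1 h2 hτ
    rw [h1 ⟨hτ.1, lt_of_le_of_ne hτ.2 h2⟩, hh'_eq τ hτ]
  calc ∫ x in E 0..E T, ψ x = ρ (E T) - ρ (E 0) := (hρ_sub _ _).symm
    _ ≤ ρ (Et T) - ρ (Et 0) := by rw [hEt0]; linarith [hρ_mono hET_le]
    _ ≤ ∫ τ in Ioc 0 T, ψ (Et τ) * h' τ := hmain
    _ = ∫ τ in (0 : ℝ)..T, ψ (E τ) * h τ := hrhs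

end Literature.Analysis.FluidPDE
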